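import Mathlib
import Summits.ValiantsHypothesis.ValiantsHypothesis.Theses.ValuativeGCT
import Summits.ValiantsHypothesis.ValiantsHypothesis.Theses.GCTMult
import Summits.ValiantsHypothesis.ValiantsHypothesis.Theorems.ValuativeGCTValuativeFlipAboveBottom
import Summits.ValiantsHypothesis.ValiantsHypothesis.Theorems.ValuativeGCTValuativeBound

/-!
# `ValuativeGCT.ValuativeFlip` (stmt-ValiantsHypothesis-12624) implies `GCTMult.GctMultFlip`
# (stmt-ValiantsHypothesis-0887) — unconditionally

Line `skew-restriction-rank` for crux `ValuativeGCT.ValuativeFlip` (route-ValiantsHypothesis-ValuativeGCT), third line lead,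
2026-08-16 — piece H3c of the crux's logical position.

## What

`gctMultFlip_of_valuativeFlip_unconditional : ValuativeFlip → GCTMult.GctMultFlip`: a valuative flip
`dim T_U(λ) < mult_{λ*} ℂ[Δ_m(X₀₀^{m-n} per_n)]` at a window position `(n, m)` is a classical Mulmuley–Sohoni
multiplicity obstruction there, because the route's valuative bound `K_m(λ*) ≤ dim T_U(λ)` (`ValuativeBound`,
stmt-ValiantsHypothesis-12625) is now a THEOREM of the tree (`ValuativeBound.ValuativeBound_proof`, the Φ-injection over
`CoeffVanishingOrder_proof`).  This is `gctMultFlip_of_valuativeFlip` (H3b, file `ValuativeGCTValuativeFlipAboveBottom`)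
with its hypothesis discharged.

## Why it matters

With H3a (`valuativeFlip_of_gctKroneckerFlip`, file `ValuativeGCTValuativeFlipOfKroneckerFlip`) and H1
(`valuativeFlip_iff_aboveBottom`) the crux sits, with NO side hypotheses, between the two classical flips of route GCTMult:
`GctKroneckerFlip (0888) ⇒ ValuativeFlip (12624) ⇔ ValuativeFlip above the bottom ⇒ GctMultFlip (0887)`.
In particular any proof of the crux exhibits multiplicity obstructions for the padded permanent at every position
`m ∈ (n, 2^((log₂ n + c)^c)]` of every window — none is known in print at any `m ≥ n + 1`.

## Sources

* K. Mulmuley, M. Sohoni, *Geometric complexity theory II*, SIAM J. Comput. 38 (2008) (multiplicity obstructions).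
  [Mulmuley–Sohoni 2008]
* P. Bürgisser, J. M. Landsberg, L. Manivel, J. Weyman, SIAM J. Comput. 40(4) (2011) §3.3, §5.2. [BLMW 2011]
* J. Hüttenhain, *A note on normalizations of orbit closures*, arXiv:1512.04352, Thm 4 (source of the Φ-injection). [Hüttenhain 2017]
-/

set_option linter.dupNamespace false

namespace Summit.ValiantsHypothesis.ValiantsHypothesis.Theorems.ValuativeFlip

/-- **H3c — the crux implies the classical multiplicity flip, unconditionally.**  `ValuativeFlip`
(stmt-ValiantsHypothesis-12624) implies `GCTMult.GctMultFlip` (stmt-ValiantsHypothesis-0887): H3b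
`gctMultFlip_of_valuativeFlip` with its hypothesis `ValuativeBound` (stmt-12625) discharged by the landed
`ValuativeBound.ValuativeBound_proof` (`K_m(λ*) ≤ dim T_U(λ) < mult_pp(λ*)`, witness weight `χ := λ*`).
[Mulmuley–Sohoni 2008; BLMW 2011 §3.3; this line] -/
theorem gctMultFlip_of_valuativeFlip_unconditional
    (hF : Summit.ValiantsHypothesis.ValiantsHypothesis.Theses.ValuativeGCT.ValuativeFlip) :
    Summit.ValiantsHypothesis.ValiantsHypothesis.Theses.GCTMult.GctMultFlip :=
  gctMultFlip_of_valuativeFlip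
    Summit.ValiantsHypothesis.ValiantsHypothesis.Theorems.ValuativeBound.ValuativeBound_proof hF

end Summit.ValiantsHypothesis.ValiantsHypothesis.Theorems.ValuativeFlip
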